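import Summits.QuantumFields.BalabanUV.Beta.SpineRecursiveT2All

/-!
# `BalabanUV.Beta.SecondOrderLockPin` — binder row D1, (L4): **THE SECOND-ORDER LOCK (W-L-2) AT THE TREE'S WEIGHTS IS THE PIN `cE₂ = Lc⁸`**, and
# `hR ⟸ letters` with the lock DISCHARGED at that pin (β sub-cell, row BETA-an2 = BINDER-OWNERS row D1 OWNER, lineage an2 gen 18; memo `SKELETON-D1-L4.v2` §2)

HONEST FRAMING (cell charter, verbatim): «discharging BetaPertH makes Balaban's UV stability UNCONDITIONAL — a real
constructive-QFT result; it is NOT the continuum limit and NOT the Clay problem.»  DERIVED cell leaf (units bookkeeping, [folklore]); no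
statement of Bałaban's papers, no `[cite:]`, no `def`, no `Prop` fact; instantiates no binder of the wall.  The numeral is DISPLAYED, not RULED
((R45)/(P6) are the β-leads').  NOT D1, NOT `BetaPertH`, NOT continuum, NOT Clay.

* `lock2_iff`: at the tree's (provisional) weights `wE j = (Lc^j)^{15}`, `wVH j = (Lc^j)^{10}`, `wV4 j = (Lc^j)^{20}` (`d + 1 = 4`), for every `j`,
  `cE₂·wV4 (j+1)·wVH (j+1) = (Lc⁴·wE (j+1))² ↔ cE₂ = Lc⁸`; `lock2_of_bcj2`: the lock at every level from `cE₂ = Lc⁸` — the SAME numeral as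
  gan24's `hpinEq : cE₂ = Lc^(2(d+1))` (road W3), reached independently.
* **`axisReflectionCovariant_flipK_TbalOf_JsRecWAtOf_of_letters_bcj2`**: `SpineRecursiveT2All.…_of_letters` at `cE₂ := Lc⁸` — hR for the recursive
  wall literal v2.26 with its W-literal ⟸ the letters + mechanical leaves ONLY (both units locks discharged at the pins `cE = Lc⁴`, `cE₂ = Lc⁸`).
Provenance: β sub-cell, unit beta-an2 gen 18, 2026-08-20 (v1); no existing file touched.
-/

open Finset
open scoped BigOperators
open Literature.MathematicalPhysics.QuantumFieldTheory
open Literature.MathematicalPhysics.QuantumFieldTheory.Balaban1983to89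
open Literature.MathematicalPhysics.QuantumFieldTheory.Balaban1983to89.Beta
open ExpKernelCalculus (MKer Decays BiLoc comp tadpole VertexFamily VertexFamily₂ shiftK)
open AffineAveraging (box toSite)
open AveragingContoursRooted (ctr ctrOff ctrOff_mem_box)
open PolarizationSign (reflSign AxisReflectionCovariant)
open KernelReflection (refK)
open ResolventReflection (bref Φ)
open OneStepResolventKernel (Fib LocStencil JetData)
open OneStepKernelFamily (KInvStep colH vertexOfK TbalOf flipK)
open BalabanStepJetsSucc (mmRead wE wVH)
open BalabanStepW2 (M2Of K3OfK wV4 wB2)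
open BalabanCompositeJets (LocStencil₂)
open SecondOrderResponse (dM W2OfK LocStencilFM)
open Summit.QuantumFields.BalabanUV.Beta.TameKernelCalculus
open Summit.QuantumFields.BalabanUV.Beta.ChartConjugation (conjV conjW)
open Summit.QuantumFields.BalabanUV.Beta.AxialDressingRooted (coDressKBmAt)
open Summit.QuantumFields.BalabanUV.Beta.BorderedHessian (diagK ctGen bhKStepAt stepScale)
open Summit.QuantumFields.BalabanUV.Beta.WardLocusCubic (mmSym)

noncomputable section

namespace Summit.QuantumFields.BalabanUV.Beta.SpineRooted

section Lock

variable {Lc : ℕ} [NeZero Lc]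

omit [NeZero Lc] in
/-- [folklore] The tree's weights as powers: `wE 3 Lc j = ((Lc^j)^5)^3`, `wVH 3 Lc j = ((Lc^j)^5)^2`, `wV4 3 Lc j = ((Lc^j)^5)^4`. -/
theorem weights_pow (j : ℕ) : wE 3 Lc j = (((Lc : ℝ) ^ j) ^ 5) ^ 3 ∧ wVH 3 Lc j = (((Lc : ℝ) ^ j) ^ 5) ^ 2 ∧ wV4 3 Lc j = (((Lc : ℝ) ^ j) ^ 5) ^ 4 := by
  refine ⟨?_, ?_, ?_⟩
  · simp only [BalabanStepJetsSucc.wE]; ring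
  · simp only [BalabanStepJetsSucc.wVH]; ring
  · simp only [BalabanStepW2.wV4]; ring

/-- [folklore] **(W-L-2) AT THE TREE'S WEIGHTS IS THE PIN `cE₂ = Lc⁸`**: for every `j`,
`cE₂·wV4 3 Lc (j+1)·wVH 3 Lc (j+1) = (Lc⁴·wE 3 Lc (j+1))² ↔ cE₂ = Lc⁸`. -/
theorem lock2_iff (cE₂ : ℝ) (j : ℕ) :
    cE₂ * wV4 3 Lc (j + 1) * wVH 3 Lc (j + 1) = ((Lc : ℝ) ^ 4 * wE 3 Lc (j + 1)) ^ 2 ↔ cE₂ = (Lc : ℝ) ^ 8 := by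
  obtain ⟨h1, h2, h3⟩ := weights_pow (Lc := Lc) (j + 1)
  have hL : (0 : ℝ) < Lc := by exact_mod_cast Nat.pos_of_ne_zero (NeZero.ne Lc)
  set s : ℝ := ((Lc : ℝ) ^ (j + 1)) ^ 5 with hs
  have hs0 : s ≠ 0 := by positivity
  rw [h1, h2, h3]
  constructor
  · intro h
    have h' : cE₂ * s ^ 6 = (Lc : ℝ) ^ 8 * s ^ 6 := by nlinarith [h]
    exact mul_right_cancel₀ (pow_ne_zero 6 hs0) h'
  · intro h
    rw [h]; ring

/-- [folklore] **THE SECOND-ORDER LOCK AT EVERY LEVEL FROM THE PIN `cE₂ = Lc⁸`.** -/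
theorem lock2_of_bcj2 (cE₂ : ℝ) (h : cE₂ = (Lc : ℝ) ^ 8) (j : ℕ) :
    cE₂ * wV4 3 Lc (j + 1) * wVH 3 Lc (j + 1) = ((Lc : ℝ) ^ 4 * wE 3 Lc (j + 1)) ^ 2 :=
  (lock2_iff cE₂ j).2 h

end Lock

section Pin

variable {Lc : ℕ} [NeZero Lc]

/-- [folklore] **hR FOR THE RECURSIVE WALL LITERAL v2.26 WITH ITS W-LITERAL AT THE PIN `cE₂ = Lc⁸` ⟸ THE LETTERS + MECHANICAL LEAVES ONLY**
(`SpineRecursiveT2All.…_of_letters` with (W-L-2) discharged by `lock2_of_bcj2`). -/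
theorem axisReflectionCovariant_flipK_TbalOf_JsRecWAtOf_of_letters_bcj2 (hLc : Odd Lc) (cΛ cB : ℝ) (T : Fin 4 → Fin 4 → Fin 4 → Fin 4 → ℝ)
    {vh₂S : Fin 4 → (Fin 4 → ℤ) → Fin 4 → (Fin 4 → ℤ) → MKer 4 (Fib 3)} (hB : ∃ C δ : ℝ, 0 < δ ∧ LocStencil₂ vh₂S C δ)
    (hB0 : ∀ κ u κ' u' (x z : Fin 4 → ℤ) (β β' : Fin 4), vh₂S κ u κ' u' x z (Sum.inl β) (Sum.inl β') = 0)
    {mixFF : Fin 4 → (Fin 4 → ℤ) → Fin 4 → (Fin 4 → ℤ) → MKer 4 (Fib 3)} (hmix : ∃ C δ : ℝ, 0 < δ ∧ LocStencilFM Lc mixFF C δ)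
    (γ : ℕ → ℝ) (hγ : ∀ j, γ j = -((Lc : ℝ) ^ 8 / 2) * wVH 3 Lc j / (stepScale 3 Lc j * (Lc : ℝ) ^ 4))
    (h : ℕ → Fin 4 → Fin 4 → (Fin 4 → ℤ) → Fin 4 → (Fin 4 → ℤ) → (Fin 4 → ℤ) → Fib 3 → ℝ)
    (R2 : ℕ → Fin 4 → Fin 4 → (Fin 4 → ℤ) → Fin 4 → (Fin 4 → ℤ) → MKer 4 (Fib 3))
    (RM : ℕ → Fin 4 → Fin 4 → (Fin 4 → ℤ) → Fin 4 → (Fin 4 → ℤ) → MKer 4 (Fib 3))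
    (h0 : ∀ (α κ : Fin 4) (u : Fin 4 → ℤ) (κ' : Fin 4) (u' : Fin 4 → ℤ),
      T2RecAt 3 Lc (toSite (ctrOff 4 Lc)) ((Lc : ℝ) ^ 4) (-((Lc : ℝ) ^ 8 / 2)) cΛ ((Lc : ℝ) ^ 8) cB T vh₂S mixFF 0 κ (bref α κ u) κ' (bref α κ' u') =
        (reflSign α κ * reflSign α κ') • refK (Φ Lc α)
          (T2RecAt 3 Lc (toSite (ctrOff 4 Lc)) ((Lc : ℝ) ^ 4) (-((Lc : ℝ) ^ 8 / 2)) cΛ ((Lc : ℝ) ^ 8) cB T vh₂S mixFF 0 κ u κ' u' +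
            conjW (bhKStepAt 3 (toSite (ctrOff 4 Lc)) Lc 0)
              (SpureRecAt 3 Lc (toSite (ctrOff 4 Lc)) ((Lc : ℝ) ^ 4) (-((Lc : ℝ) ^ 8 / 2)) cΛ 0 κ u)
              (SpureRecAt 3 Lc (toSite (ctrOff 4 Lc)) ((Lc : ℝ) ^ 4) (-((Lc : ℝ) ^ 8 / 2)) cΛ 0 κ' u')
              (diagK fun p c => γ 0 * ctGen 3 α Lc κ u p c) (diagK fun p c => γ 0 * ctGen 3 α Lc κ' u' p c) (diagK (h 0 α κ u κ' u')) +
            R2 0 α κ u κ' u'))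
    (hM2 : ∀ (j : ℕ) (α κ : Fin 4) (u : Fin 4 → ℤ) (ρ : Fin 4) (w : Fin 4 → ℤ),
      M2Of 3 Lc mixFF j κ (bref α κ u) ρ (bref α ρ w) =
        (reflSign α κ * reflSign α ρ) • refK (Φ Lc α)
          (M2Of 3 Lc mixFF j κ u ρ w + conjV (M1At 3 Lc (toSite (ctrOff 4 Lc)) cΛ j ρ w) (diagK fun p c => γ j * ctGen 3 α Lc κ u p c) +
            RM j α κ u ρ w))
    (X2s : ℕ → Fin 4 → Fin 4 → (Fin 4 → ℤ) → Fin 4 → (Fin 4 → ℤ) → (Fin 4 → ℤ) → Fib 3 → ℝ)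
    (Δ : ℕ → Fin 4 → Fin 4 → (Fin 4 → ℤ) → Fin 4 → (Fin 4 → ℤ) → MKer 4 (Fib 3))
    (hsplit : ∀ (j : ℕ) (α μ : Fin 4) (y : Fin 4 → ℤ) (ν : Fin 4) (y' : Fin 4 → ℤ),
      W2OfK (coDressKBmAt (toSite (ctrOff 4 Lc)) Lc (KInvStep (d := 3) Lc j)) Lc
          (fun κ u => SpureRecAt 3 Lc (toSite (ctrOff 4 Lc)) ((Lc : ℝ) ^ 4) (-((Lc : ℝ) ^ 8 / 2)) cΛ j κ u +
            conjV (bhKStepAt 3 (toSite (ctrOff 4 Lc)) Lc j) (diagK fun p c => γ j * ctGen 3 α Lc κ u p c))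
          (M1At 3 Lc (toSite (ctrOff 4 Lc)) cΛ j)
          (fun κ u κ' u' => T2RecAt 3 Lc (toSite (ctrOff 4 Lc)) ((Lc : ℝ) ^ 4) (-((Lc : ℝ) ^ 8 / 2)) cΛ ((Lc : ℝ) ^ 8) cB T vh₂S mixFF j κ u κ' u' +
            conjW (bhKStepAt 3 (toSite (ctrOff 4 Lc)) Lc j)
              (SpureRecAt 3 Lc (toSite (ctrOff 4 Lc)) ((Lc : ℝ) ^ 4) (-((Lc : ℝ) ^ 8 / 2)) cΛ j κ u)
              (SpureRecAt 3 Lc (toSite (ctrOff 4 Lc)) ((Lc : ℝ) ^ 4) (-((Lc : ℝ) ^ 8 / 2)) cΛ j κ' u')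
              (diagK fun p c => γ j * ctGen 3 α Lc κ u p c) (diagK fun p c => γ j * ctGen 3 α Lc κ' u' p c) (diagK (h j α κ u κ' u')) +
            R2 j α κ u κ' u')
          (fun κ u ρ w => M2Of 3 Lc mixFF j κ u ρ w + conjV (M1At 3 Lc (toSite (ctrOff 4 Lc)) cΛ j ρ w) (diagK fun p c => γ j * ctGen 3 α Lc κ u p c) +
            RM j α κ u ρ w)
          μ y ν y' =
        W2OfK (coDressKBmAt (toSite (ctrOff 4 Lc)) Lc (KInvStep (d := 3) Lc j)) Lc
            (SpureRecAt 3 Lc (toSite (ctrOff 4 Lc)) ((Lc : ℝ) ^ 4) (-((Lc : ℝ) ^ 8 / 2)) cΛ j) (M1At 3 Lc (toSite (ctrOff 4 Lc)) cΛ j)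
            (T2RecAt 3 Lc (toSite (ctrOff 4 Lc)) ((Lc : ℝ) ^ 4) (-((Lc : ℝ) ^ 8 / 2)) cΛ ((Lc : ℝ) ^ 8) cB T vh₂S mixFF j) (M2Of 3 Lc mixFF j) μ y ν y' +
          conjW (bhKStepAt 3 (toSite (ctrOff 4 Lc)) Lc j)
            (dM (coDressKBmAt (toSite (ctrOff 4 Lc)) Lc (KInvStep (d := 3) Lc j)) Lc
              (SpureRecAt 3 Lc (toSite (ctrOff 4 Lc)) ((Lc : ℝ) ^ 4) (-((Lc : ℝ) ^ 8 / 2)) cΛ j) (M1At 3 Lc (toSite (ctrOff 4 Lc)) cΛ j) μ y)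
            (dM (coDressKBmAt (toSite (ctrOff 4 Lc)) Lc (KInvStep (d := 3) Lc j)) Lc
              (SpureRecAt 3 Lc (toSite (ctrOff 4 Lc)) ((Lc : ℝ) ^ 4) (-((Lc : ℝ) ^ 8 / 2)) cΛ j) (M1At 3 Lc (toSite (ctrOff 4 Lc)) cΛ j) ν y')
            (diagK fun p c => ∑ κ, ∑' u, colH (coDressKBmAt (toSite (ctrOff 4 Lc)) Lc (KInvStep (d := 3) Lc j)) Lc μ y κ u * (γ j * ctGen 3 α Lc κ u p c))
            (diagK fun p c => ∑ κ, ∑' u, colH (coDressKBmAt (toSite (ctrOff 4 Lc)) Lc (KInvStep (d := 3) Lc j)) Lc ν y' κ u * (γ j * ctGen 3 α Lc κ u p c))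
            (diagK (X2s j α μ y ν y')) +
          Δ j α μ y ν y')
    (hDg : ∀ (j : ℕ) (α ν : Fin 4) (y' : Fin 4 → ℤ),
      Loc (dM (coDressKBmAt (toSite (ctrOff 4 Lc)) Lc (KInvStep (d := 3) Lc j)) Lc
        (fun κ u => SpureRecAt 3 Lc (toSite (ctrOff 4 Lc)) ((Lc : ℝ) ^ 4) (-((Lc : ℝ) ^ 8 / 2)) cΛ j κ u +
          conjV (bhKStepAt 3 (toSite (ctrOff 4 Lc)) Lc j) (diagK fun p c => γ j * ctGen 3 α Lc κ u p c))
        (M1At 3 Lc (toSite (ctrOff 4 Lc)) cΛ j) ν y'))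
    (hX2L : ∀ j α μ y ν y', Loc (diagK (X2s j α μ y ν y'))) (hΔL : ∀ j α μ y ν y', Loc (Δ j α μ y ν y'))
    (RB : ℕ → Fin 4 → Fin 4 → (Fin 4 → ℤ) → Fin 4 → (Fin 4 → ℤ) → MKer 4 (Fib 3))
    (hRBff : ∀ j α κ u κ' u' (x z : Fin 4 → ℤ) (β β' : Fin 4), RB j α κ u κ' u' x z (Sum.inl β) (Sum.inl β') = 0)
    (hBfm : ∀ (j : ℕ) (α : Fin 4) κ u κ' u' (x z : Fin 4 → ℤ) (β m : Fin 4),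
      ((cB * wB2 3 Lc (j + 1)) • vh₂S κ (bref α κ u) κ' (bref α κ' u')) x z (Sum.inl β) (Sum.inr m) =
        ((reflSign α κ * reflSign α κ') • refK (Φ Lc α) ((cB * wB2 3 Lc (j + 1)) • vh₂S κ u κ' u' +
          conjW (bhKStepAt 3 (toSite (ctrOff 4 Lc)) Lc (j + 1))
            (SpureRecAt 3 Lc (toSite (ctrOff 4 Lc)) ((Lc : ℝ) ^ 4) (-((Lc : ℝ) ^ 8 / 2)) cΛ (j + 1) κ u)
            (SpureRecAt 3 Lc (toSite (ctrOff 4 Lc)) ((Lc : ℝ) ^ 4) (-((Lc : ℝ) ^ 8 / 2)) cΛ (j + 1) κ' u')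
            (diagK fun p c => γ (j + 1) * ctGen 3 α Lc κ u p c) (diagK fun p c => γ (j + 1) * ctGen 3 α Lc κ' u' p c) (diagK (h (j + 1) α κ u κ' u')) +
          RB (j + 1) α κ u κ' u')) x z (Sum.inl β) (Sum.inr m))
    (hBmf : ∀ (j : ℕ) (α : Fin 4) κ u κ' u' (x z : Fin 4 → ℤ) (m β : Fin 4),
      ((cB * wB2 3 Lc (j + 1)) • vh₂S κ (bref α κ u) κ' (bref α κ' u')) x z (Sum.inr m) (Sum.inl β) =
        ((reflSign α κ * reflSign α κ') • refK (Φ Lc α) ((cB * wB2 3 Lc (j + 1)) • vh₂S κ u κ' u' +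
          conjW (bhKStepAt 3 (toSite (ctrOff 4 Lc)) Lc (j + 1))
            (SpureRecAt 3 Lc (toSite (ctrOff 4 Lc)) ((Lc : ℝ) ^ 4) (-((Lc : ℝ) ^ 8 / 2)) cΛ (j + 1) κ u)
            (SpureRecAt 3 Lc (toSite (ctrOff 4 Lc)) ((Lc : ℝ) ^ 4) (-((Lc : ℝ) ^ 8 / 2)) cΛ (j + 1) κ' u')
            (diagK fun p c => γ (j + 1) * ctGen 3 α Lc κ u p c) (diagK fun p c => γ (j + 1) * ctGen 3 α Lc κ' u' p c) (diagK (h (j + 1) α κ u κ' u')) +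
          RB (j + 1) α κ u κ' u')) x z (Sum.inr m) (Sum.inl β))
    (hBmm : ∀ (j : ℕ) (α : Fin 4) κ u κ' u' (x z : Fin 4 → ℤ) (m m' : Fin 4),
      ((cB * wB2 3 Lc (j + 1)) • vh₂S κ (bref α κ u) κ' (bref α κ' u')) x z (Sum.inr m) (Sum.inr m') =
        ((reflSign α κ * reflSign α κ') • refK (Φ Lc α) ((cB * wB2 3 Lc (j + 1)) • vh₂S κ u κ' u' +
          conjW (bhKStepAt 3 (toSite (ctrOff 4 Lc)) Lc (j + 1))
            (SpureRecAt 3 Lc (toSite (ctrOff 4 Lc)) ((Lc : ℝ) ^ 4) (-((Lc : ℝ) ^ 8 / 2)) cΛ (j + 1) κ u)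
            (SpureRecAt 3 Lc (toSite (ctrOff 4 Lc)) ((Lc : ℝ) ^ 4) (-((Lc : ℝ) ^ 8 / 2)) cΛ (j + 1) κ' u')
            (diagK fun p c => γ (j + 1) * ctGen 3 α Lc κ u p c) (diagK fun p c => γ (j + 1) * ctGen 3 α Lc κ' u' p c) (diagK (h (j + 1) α κ u κ' u')) +
          RB (j + 1) α κ u κ' u')) x z (Sum.inr m) (Sum.inr m'))
    (hR2succ : ∀ (j : ℕ) (α κ : Fin 4) (u : Fin 4 → ℤ) (κ' : Fin 4) (u' : Fin 4 → ℤ),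
      R2 (j + 1) α κ u κ' u' =
        -((((Lc : ℝ) ^ 8) * wV4 3 Lc (j + 1)) • mmRead Lc
            (comp (comp (coDressKBmAt (toSite (ctrOff 4 Lc)) Lc (KInvStep (d := 3) Lc j))
              ((1 / 2 : ℝ) • conjV (bhKStepAt 3 (toSite (ctrOff 4 Lc)) Lc j) (diagK fun p a => X2s j α κ' u' κ u p a - X2s j α κ u κ' u' p a) +
                (1 / 2 : ℝ) • (Δ j α κ u κ' u' + Δ j α κ' u' κ u)))
              (coDressKBmAt (toSite (ctrOff 4 Lc)) Lc (KInvStep (d := 3) Lc j)))) +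
          RB (j + 1) α κ u κ' u' +
          conjV (mmRead Lc (coDressKBmAt (toSite (ctrOff 4 Lc)) Lc (KInvStep (d := 3) Lc j)))
            (diagK fun p c => ((Lc : ℝ) ^ 8) * wV4 3 Lc (j + 1) * mmSym Lc (X2s j α κ u κ' u') p c - wVH 3 Lc (j + 1) * h (j + 1) α κ u κ' u' p c))
    (hBt : ∀ (κ : Fin 4) (u : Fin 4 → ℤ) (κ' : Fin 4) (u' t : Fin 4 → ℤ),
      vh₂S κ (u + (Lc : ℤ) • t) κ' (u' + (Lc : ℤ) • t) = shiftK (-((Lc : ℤ) • t)) (vh₂S κ u κ' u'))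
    (hmixt : ∀ (κ : Fin 4) (u : Fin 4 → ℤ) (μ : Fin 4) (w t : Fin 4 → ℤ),
      mixFF κ (u + (Lc : ℤ) • t) μ (w + t) = shiftK (-((Lc : ℤ) • t)) (mixFF κ u μ w))
    (hΔ0 : ∀ j α μ y ν y', tadpole (coDressKBmAt (toSite (ctrOff 4 Lc)) Lc (KInvStep (d := 3) Lc j)) (Δ j α μ y ν y') = 0) :
    ∀ j : ℕ, AxisReflectionCovariant
      (flipK (TbalOf Lc (JsRecWAtOf (d := 3) hLc.pos (ctrOff_mem_box hLc.pos) ((Lc : ℝ) ^ 4) (-((Lc : ℝ) ^ 8 / 2)) cΛ ((Lc : ℝ) ^ 8) cB T hB hmix) j)) :=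
  axisReflectionCovariant_flipK_TbalOf_JsRecWAtOf_of_letters hLc cΛ ((Lc : ℝ) ^ 8) cB T hB hB0 hmix γ hγ (lock2_of_bcj2 _ rfl) h R2 RM h0 hM2 X2s Δ
    hsplit hDg hX2L hΔL RB hRBff hBfm hBmf hBmm hR2succ hBt hmixt hΔ0

end Pin

end Summit.QuantumFields.BalabanUV.Beta.SpineRooted

end
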